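import Summits.QuantumFields.YangMills.Theorems.BalabanUVNodesPortS1JacobianHoloCov
import Literature.MathematicalPhysics.QuantumFieldTheory.Balaban1983to89.B15AveragingHolomorphicLocal

/-!
# NODE O port PT-A — THE HOLOMORPHIC (0.4) LOOP MATRICES OF AN `SL(2,ℂ)`-VALUED FIELD IN THE PRIVATE COORDINATE `β(c)`: holomorphic walk products concatenate, read only the bonds they
# visit and REVERSE TO THE ADJUGATE (`2 × 2`); `loop_i = open_i · adj(axial)`, CENTRAL LOOPS ARE `1` (the runs cancel at determinant one), `axial = pre · W(β(c)) · post`, and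
# `open_i` (non-central), `pre`, `post` DO NOT READ `W(β(c))` — BlockAveragingHaarAC's group-level normal-form facts MIRRORED for `B15AveragingHolomorphic.holMh`

Cell `ym-nodeO-ideate`, porter seat `ymgap-nodeO-port-PTZ-1` (gen 6) as STUB-WORKER under the `stub_LZjac` line of 27930's skeleton `pta_residueW` (director-ym №522 (2): item (3) of
▶ PTA-1 g5's gen-6 list, PORT-PLAN-v5 §4 rows (a)(b) «on the whole complex domain»); `--supports stmt-QuantumFields-27930` (helper), NO `--workitem`.  [I] = [Balaban1987RG1],
[15] = [Balaban1985Variational].  FILE (A) of three: the word ∕ walk bookkeeping the complex central-response normal form (file (B) `…JacobianHoloDomain`) rests on.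
CONSUMED BY NAME, nothing modified: `B15AveragingHolomorphic` (`holMh`, `stepMh`, `loopMh`, `axialMh`, `holMh_nil ∕ _cons`), dag-n12-c's `B15AveragingHolomorphicLocal.holMh_congr`, ✓p812756 `…JacobianHoloSL2` (`det_holMh_eq_one`),
✓p812578 `…JacobianHoloCov` (`adjugate_mul_self_of_det_eq_one`, `self_mul_adjugate_of_det_eq_one`, `adjugate_adjugate_two`), the WORD-LEVEL lemmas of `T4Continuum` ∕ `BlockAveragingHaarAC`
∕ `AveragingRT` (`walk_append`, `walkEnd_walkEnd_wordRev`, `wordRev_cons`, `walkEnd_replicate_line`, `openWord`, `loopWord_eq_openWord_append`, `walkEnd_openWord`, `replicate_false_eq_wordRev`,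
`stairWord_eq_axisRun_of_forall_ne`, `central_of_mem_walk_openWord`, `mem_walk_replicate`, `L_dvd_of_emb_add_eq`, `eq_zero_of_L_dvd`, `lineSite_apply_int`, `lineSite_succ`,
`two_mul_half_add_one`) and Mathlib's `Matrix.adjugate_mul_distrib`.  The proofs are the group proofs of `BlockAveraging.holAt_walk_wordRev`, `BlockAveragingHaarAC.holAt_walk_openWord_of_forall_ne`,
`loopHol_eq_openHol_mul`, `openHol_update_of_not_isCentral`, `axialAvg_eq_pre_mul_mul_post`, `pre_update`, `post_update`, `axialAvg_update_centralBond` with `⁻¹ ↦ adj` (valid at `det = 1`).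
PLACEHOLDER
* §2 ★ `loopMh_eq_open_mul_adjugate`, ★ `holMh_openWord_of_forall_ne`, ★ `loopMh_of_isCentral` (central loop matrices are `1` at determinant one), `holMh_openWord_update_of_not_isCentral`,
  ★ `axialMh_eq_pre_mul_mul_post`, `holMh_pre_update`, `holMh_post_update`, ★ `axialMh_update_centralBond`.

HONEST FRAMING.  Kernel bookkeeping over the tree's own holomorphic model and word lemmas; NOTHING of Bałaban's estimates asserted, ported or discharged; `stub_LZjac` OPEN; `stub_LZdet` BLOCKED-ON
P0 (α)+(β); `stub_FE` XXL; 27930 OPEN · no claim; 26648 OPEN; K0⁷∕K-Ax OPEN; NODE O 0∕1; COUNT 8∕28 · K 1∕4 UNMOVED; finite `𝕋⁴_{L^K}` at fixed ε — NOT continuum ∕ OS ∕ Clay; **the Yang–Mills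
mass gap is NOT proved by any of this.**  No `sorry`, no `def`, no `instance`, no `notation`; standard axioms.
-/

noncomputable section

open scoped BigOperators Matrix.Norms.L2Operator Topology

namespace Summit.QuantumFields.YangMills.Theorems.BalabanUVNodesPortS1

open Summit.QuantumFields.YangMills.Theorems.K0RecordFormatNames
open Literature.MathematicalPhysics.QuantumFieldTheory.Balaban1983to89
open Literature.MathematicalPhysics.QuantumFieldTheory.Balaban1983to89.Node00
open Literature.MathematicalPhysics.QuantumFieldTheory.Balaban1983to89.T4Continuum
  (T4Family LStep walk walkEnd Letter wordRev stairWord axisRun walk_append walkEnd_walkEnd_wordRev wordRev_cons walkEnd_replicate_line)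
open Literature.MathematicalPhysics.QuantumFieldTheory.Balaban1983to89.BlockAveraging (Idx off)
open Literature.MathematicalPhysics.QuantumFieldTheory.Balaban1983to89.BlockAveragingHaarAC
  (centralBond IsCentral nCentral openWord loopWord_eq_openWord_append walkEnd_openWord replicate_false_eq_wordRev wordRev_replicate_false
   stairWord_eq_axisRun_of_forall_ne central_of_mem_walk_openWord mem_walk_replicate L_dvd_of_emb_add_eq eq_zero_of_L_dvd lineSite_apply_int)
open Literature.MathematicalPhysics.QuantumFieldTheory.Balaban1983to89.AveragingRT (lineSite lineSite_succ two_mul_half_add_one)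
open Literature.MathematicalPhysics.QuantumFieldTheory.Balaban1983to89.B15AveragingHolomorphic
open Literature.MathematicalPhysics.QuantumFieldTheory.Balaban1983to89.B15AveragingHolomorphicLocal (holMh_congr)
open _root_.Matrix _root_.Filter

variable {P : Params} {j : ℕ}

/-! ## §1  Holomorphic walk products: concatenation, dependence on the bonds visited, reversal = adjugate (`2 × 2`) -/

/-- Holomorphic walk products are multiplicative under concatenation. [cite: Balaban1987RG1, (0.4) p.253 (bookkeeping)] -/
theorem holMh_append (W : PBond P j → MatA 2) (γ₁ γ₂ : List (LStep P j)) : holMh W (γ₁ ++ γ₂) = holMh W γ₁ * holMh W γ₂ := by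
  simp only [holMh, List.map_append, List.prod_append]

/-- **`holMh(−Γ) = adj holMh(Γ)`** (`2 × 2`): the product along the reversed walk (from the end of `Γ`) is the adjugate — backward steps carry adjugates, `adj(AB) = adj B · adj A`,
`adj adj = id`. [cite: Balaban1987RG1, (0.4) p.253; Balaban1985Variational, p.307 («valid for Gᶜ-valued fields»)] -/
theorem holMh_walk_wordRev (W : PBond P j → MatA 2) : ∀ (x : Site P j) (w : List (Letter P.d)),
    holMh W (walk (walkEnd x w) (wordRev w)) = (holMh W (walk x w)).adjugate
  | x, [] => by simp [walk, walkEnd, holMh_nil, wordRev]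
  | x, (μ, true) :: w => by
    have h1 : wordRev ((μ, true) :: w) = wordRev w ++ [(μ, false)] := by rw [wordRev_cons]; rfl
    rw [h1]
    simp only [walkEnd, walk]
    rw [walk_append, holMh_append, holMh_walk_wordRev W (x.shift μ) w, walkEnd_walkEnd_wordRev, holMh_cons, Matrix.adjugate_mul_distrib]
    simp [walk, holMh_cons, holMh_nil, stepMh]
  | x, (μ, false) :: w => by
    have h1 : wordRev ((μ, false) :: w) = wordRev w ++ [(μ, true)] := by rw [wordRev_cons]; rfl
    rw [h1]
    simp only [walkEnd, walk]
    rw [walk_append, holMh_append, holMh_walk_wordRev W (x.unshift μ) w, walkEnd_walkEnd_wordRev, holMh_cons, Matrix.adjugate_mul_distrib]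
    simp [walk, holMh_cons, holMh_nil, stepMh, adjugate_adjugate_two]

/-! ## §2  The (0.4) loop matrices of an `SL(2,ℂ)`-valued field in the private coordinate `β(c)`: `loop_i = open_i · adj(axial)`, central loops are `1`, the axial segment is
`pre · W(β) · post`, and `open_i` (non-central), `pre`, `post` do not read `W(β)` -/

/-- `loopMh W c i = holMh W (Γ ∪ [x,x′] ∪ (−Γ′)) · adj (axialMh W c)` (the loop word is the open word followed by `−c`). [cite: Balaban1987RG1, (0.4) p.253] -/
theorem loopMh_eq_open_mul_adjugate (W : PBond P j → MatA 2) (c : PBond P (j + 1)) (i : Idx P) :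
    loopMh W c i = holMh W (walk (emb c.src) (openWord P.L c.dir (off i.1) i.2.1 i.2.2)) * (axialMh W c).adjugate := by
  unfold loopMh axialMh
  rw [loopWord_eq_openWord_append, walk_append, holMh_append, walkEnd_openWord, replicate_false_eq_wordRev, holMh_walk_wordRev]

/-- **CENTRAL LOOPS BACKTRACK** (`SL(2,ℂ)`-valued fields): for a longitudinal offset the open part has the product of the straight line of `c` (the runs cancel: `A · adj A = det A · 1 = 1`).
[cite: Balaban1987RG1, (0.4) p.253] -/
theorem holMh_openWord_of_forall_ne (W : PBond P j → MatA 2) (hW : ∀ b, (W b).det = 1) (y : Site P (j + 1)) (μ : Fin P.d) (n : Fin P.d → ℤ)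
    (σ σ' : Equiv.Perm (Fin P.d)) (hn : ∀ ν, ν ≠ μ → n ν = 0) :
    holMh W (walk (emb y) (openWord P.L μ n σ σ')) = holMh W (walk (emb y) (List.replicate P.L (μ, true))) := by
  unfold openWord
  rw [stairWord_eq_axisRun_of_forall_ne σ n μ hn, stairWord_eq_axisRun_of_forall_ne σ' n μ hn]
  rcases le_or_gt 0 (n μ) with h0 | h0
  · have hrun : axisRun μ (n μ) = List.replicate (n μ).natAbs (μ, true) := by simp [axisRun, h0]
    rw [hrun]
    set t := (n μ).natAbs
    have hw : List.replicate t ((μ, true) : Letter P.d) ++ (List.replicate P.L (μ, true) ++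
        wordRev (List.replicate t (μ, true))) =
        List.replicate P.L (μ, true) ++ (List.replicate t (μ, true) ++ wordRev (List.replicate t (μ, true))) := by
      rw [← List.append_assoc, List.replicate_append_replicate, add_comm, ← List.replicate_append_replicate,
        List.append_assoc]
    rw [hw, walk_append, holMh_append, walk_append, holMh_append, holMh_walk_wordRev,
      self_mul_adjugate_of_det_eq_one (det_holMh_eq_one W hW _), mul_one]
  · have hrun : axisRun μ (n μ) = List.replicate (n μ).natAbs (μ, false) := by simp [axisRun, not_le.mpr h0]
    rw [hrun, wordRev_replicate_false]
    set t := (n μ).natAbs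
    have hw : List.replicate P.L ((μ, true) : Letter P.d) ++ List.replicate t (μ, true) =
        List.replicate t (μ, true) ++ List.replicate P.L (μ, true) := by
      rw [List.replicate_append_replicate, List.replicate_append_replicate, add_comm]
    rw [hw, walk_append, holMh_append, walk_append, holMh_append]
    set x₂ := walkEnd (emb y) (List.replicate t (μ, false)) with hx₂
    have hend : walkEnd x₂ (List.replicate t (μ, true)) = emb y := by
      have h := walkEnd_walkEnd_wordRev (emb y) (List.replicate t ((μ, false) : Letter P.d))
      rwa [wordRev_replicate_false] at h
    have hfirst : holMh W (walk (emb y) (List.replicate t (μ, false))) =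
        (holMh W (walk x₂ (List.replicate t (μ, true)))).adjugate := by
      have h := holMh_walk_wordRev W x₂ (List.replicate t ((μ, true) : Letter P.d))
      rwa [hend, ← replicate_false_eq_wordRev] at h
    rw [hfirst, hend, ← mul_assoc, adjugate_mul_self_of_det_eq_one (det_holMh_eq_one W hW _), one_mul]

/-- **CENTRAL LOOP MATRICES ARE `1`** for `SL(2,ℂ)`-valued fields. [cite: Balaban1987RG1, (0.4) p.253] -/
theorem loopMh_of_isCentral (W : PBond P j → MatA 2) (hW : ∀ b, (W b).det = 1) (c : PBond P (j + 1)) (i : Idx P) (h : IsCentral c i) :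
    loopMh W c i = 1 := by
  rw [loopMh_eq_open_mul_adjugate, holMh_openWord_of_forall_ne W hW c.src c.dir (off i.1) _ _ h]
  exact self_mul_adjugate_of_det_eq_one (det_holMh_eq_one W hW _)

/-- At non-central indices the open product does not read `W(β(c))`. [cite: Balaban1987RG1, (0.4) p.253 (bookkeeping)] -/
theorem holMh_openWord_update_of_not_isCentral [DecidableEq (PBond P j)] (hj : j + 1 ≤ P.m + P.K) (W : PBond P j → MatA 2)
    (c : PBond P (j + 1)) (i : Idx P) (h : ¬ IsCentral c i) (g : MatA 2) :
    holMh (Function.update W (centralBond c) g) (walk (emb c.src) (openWord P.L c.dir (off i.1) i.2.1 i.2.2)) =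
      holMh W (walk (emb c.src) (openWord P.L c.dir (off i.1) i.2.1 i.2.2)) := by
  refine holMh_congr fun s hs => Function.update_of_ne ?_ _ _
  intro hsc
  exact h (central_of_mem_walk_openWord hj c c i.1 _ _ hs hsc).2

/-- **`axialMh W c = pre · W(β(c)) · post`**: the straight segment splits at its middle bond. [cite: Balaban1987RG1, (0.4) p.253 (bookkeeping)] -/
theorem axialMh_eq_pre_mul_mul_post (W : PBond P j → MatA 2) (c : PBond P (j + 1)) :
    axialMh W c = holMh W (walk (emb c.src) (List.replicate ((P.L - 1) / 2) (c.dir, true))) * W (centralBond c) *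
      holMh W (walk (lineSite c ((P.L - 1) / 2 + 1)) (List.replicate ((P.L - 1) / 2) (c.dir, true))) := by
  unfold axialMh
  have hsplit : List.replicate P.L ((c.dir, true) : Letter P.d) =
      List.replicate ((P.L - 1) / 2) (c.dir, true) ++ ((c.dir, true) :: List.replicate ((P.L - 1) / 2) (c.dir, true)) := by
    rw [← List.replicate_succ, List.replicate_append_replicate]
    congr 1
    have := two_mul_half_add_one P
    omega
  rw [hsplit, walk_append, holMh_append, walkEnd_replicate_line]
  simp only [walk, holMh_cons, stepMh, if_true]
  rw [← lineSite_succ, mul_assoc]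
  rfl

/-- `pre` does not read `W(β(c))`. [cite: Balaban1987RG1, (0.4) p.253 (bookkeeping)] -/
theorem holMh_pre_update [DecidableEq (PBond P j)] (hj : j + 1 ≤ P.m + P.K) (W : PBond P j → MatA 2) (c : PBond P (j + 1)) (g : MatA 2) :
    holMh (Function.update W (centralBond c) g) (walk (emb c.src) (List.replicate ((P.L - 1) / 2) (c.dir, true))) =
      holMh W (walk (emb c.src) (List.replicate ((P.L - 1) / 2) (c.dir, true))) := by
  refine holMh_congr fun s hs => Function.update_of_ne ?_ _ _
  intro hsc
  obtain ⟨-, -, t', ht', hsrc⟩ := mem_walk_replicate hs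
  have h1 := hsrc c.dir
  rw [hsc, if_pos rfl] at h1
  change lineSite c _ c.dir = _ at h1
  rw [lineSite_apply_int, if_pos rfl] at h1
  have hd := L_dvd_of_emb_add_eq hj h1
  have hL := two_mul_half_add_one P
  have h0 := eq_zero_of_L_dvd hd (by omega) (by omega)
  omega

/-- `post` does not read `W(β(c))`. [cite: Balaban1987RG1, (0.4) p.253 (bookkeeping)] -/
theorem holMh_post_update [DecidableEq (PBond P j)] (hj : j + 1 ≤ P.m + P.K) (W : PBond P j → MatA 2) (c : PBond P (j + 1)) (g : MatA 2) :
    holMh (Function.update W (centralBond c) g) (walk (lineSite c ((P.L - 1) / 2 + 1)) (List.replicate ((P.L - 1) / 2) (c.dir, true))) =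
      holMh W (walk (lineSite c ((P.L - 1) / 2 + 1)) (List.replicate ((P.L - 1) / 2) (c.dir, true))) := by
  refine holMh_congr fun s hs => Function.update_of_ne ?_ _ _
  intro hsc
  obtain ⟨-, -, t', ht', hsrc⟩ := mem_walk_replicate hs
  have h1 := hsrc c.dir
  rw [hsc, if_pos rfl, lineSite_apply_int, if_pos rfl] at h1
  change lineSite c _ c.dir = _ at h1
  rw [lineSite_apply_int, if_pos rfl, add_assoc, ← Int.cast_add] at h1
  have hd := L_dvd_of_emb_add_eq hj h1
  have hL := two_mul_half_add_one P
  have h0 := eq_zero_of_L_dvd hd (by push_cast; omega) (by push_cast; omega)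
  push_cast at h0
  omega

/-- **The axial segment is affine in the private coordinate**: `axialMh (W[β ↦ g]) c = pre · g · post`. [cite: Balaban1987RG1, (0.4) p.253] -/
theorem axialMh_update_centralBond [DecidableEq (PBond P j)] (hj : j + 1 ≤ P.m + P.K) (W : PBond P j → MatA 2) (c : PBond P (j + 1)) (g : MatA 2) :
    axialMh (Function.update W (centralBond c) g) c =
      holMh W (walk (emb c.src) (List.replicate ((P.L - 1) / 2) (c.dir, true))) * g *
        holMh W (walk (lineSite c ((P.L - 1) / 2 + 1)) (List.replicate ((P.L - 1) / 2) (c.dir, true))) := by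
  rw [axialMh_eq_pre_mul_mul_post, holMh_pre_update hj, holMh_post_update hj, Function.update_self]


end Summit.QuantumFields.YangMills.Theorems.BalabanUVNodesPortS1

end
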